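import Literature.NumberTheory.QuadraticFields.ClassNumberOneBakerMediumRange
import Literature.NumberTheory.QuadraticFields.ClassNumberOneBakerLargeRange
import Literature.NumberTheory.QuadraticFields.BakerTwoLogValuesExact
import HarnessLib

/-!
# The class number one theorem (Heegner–Stark–Baker): the discharges

Topic `NumberTheory/QuadraticFields`. Sibling of `ClassNumberOneLandau.lean` and
`ClassNumberOneGenus.lean`, whose two named facts

* `BinaryQuadraticForm.HeegnerStarkPrimeThreeModEight` — for a prime `p ≡ 3 (mod 8)`,
  `h(−p) = 1 ⟹ p ∈ {3, 11, 19, 43, 67, 163}` (Cox, *Primes of the form x² + ny²*, Thm. 12.34, the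
  case "`p ≡ 3 mod 8`" to which its proof reduces, PDF p. 276 of the held copy), and
* `BinaryQuadraticForm.HeegnerStarkOddDiscr` — Cox, Thm. 7.30(i) = Thm. 12.34 for odd field
  discriminants: `D < 0`, `D ≡ 1 (mod 4)` square-free, `h(D) = 1 ⟹
  D ∈ {−3, −7, −11, −19, −43, −67, −163}` (PDF p. 162: "due independently to Baker [3],
  Heegner [52] and Stark [96]"),

are PROVED here (`…_holds`), by assembling the tree's formalisation of **Baker's route**
(A. Baker, *Transcendental Number Theory* (1975), Ch. 5 §4, pp. 50–51): for a prime
`p₀ ≡ 3 (mod 8)`, `p₀ > 163`, with `h(−p₀) = 1`, the limit formula gives Baker's fundamental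
inequality `|105 h₂₁ X₂₁ − 66 h₃₃ X₃₃| ≤ 35280 e^{−π√p₀/21} + 34848 e^{−π√p₀/33}`
(`ClassNumberOneBakerFundamental.lean`, `heegnerStarkPrimeThreeModEight_of_ranges`), where
`X₂₁ = 2 log ((5 + √21)/2)`, `X₃₃ = 2 log (23 + 4√33)` (`BakerTwoLogValuesExact.lean`:
`bakerX_21_eq`, `bakerX_33_eq`, i.e. `h(21) = h(33) = 1`); the inequality fails

* for `500000 < p₀ ≤ 10¹⁰⁰` by two kernel-checked continued-fraction certificates
  (`ClassNumberOneBakerMediumRange.lean`, `heegnerStarkPrimeThreeModEight_of_large_above`), and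
* for `p₀ > 10⁸⁰` by the tree's explicit lower bound for linear forms in two logarithms
  (`ClassNumberOneBakerLargeRange.lean`, `baker_large_range`),

while the range `p₀ ≤ 500000` is a kernel search for a second reduced form
(`ClassNumberOneSmallRange.lean`, `heegnerStarkPrime_small`). The reduction of odd `d_K` to
`d_K = −p`, `p ≡ 3 (mod 8)` is the first ("quite elementary") part of Cox's proof of Thm. 12.34
(`ClassNumberOneGenus.lean`, `heegnerStarkOddDiscr_of_prime`). Nothing new is stated in this
file; it only composes theorems of the tree, so that Cox's Thm. 7.30(ii) for all orders
(`mem_classNumberOneDiscrs_of_classNumber_eq_one_of_heegnerStarkPrime`) and its users become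
unconditional.

## References

* [Cox2013] D. A. Cox, *Primes of the form x² + ny²*, 2nd ed., Wiley 2013: §7.D **Thm. 7.30**,
  PDF p. 162; §12.E **Thm. 12.34** and the first part of its proof, PDF pp. 275–276.
* [Baker1975] A. Baker, *Transcendental Number Theory* (1975), Ch. 5 §4 (pp. 50–51).
* K. Heegner, Math. Z. 56 (1952), 227–253; H. M. Stark, Michigan Math. J. 14 (1967), 1–27;
  A. Baker, Mathematika 13 (1966), 204–216 (Cox's [52], [96], [3]).
-/

namespace Literature.NumberTheory.QuadraticFields.BinaryQuadraticForm

open BakerLimitFormula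

/-- **The Heegner–Stark–Baker theorem for `d_K = −p`, `p ≡ 3 (mod 8)`** (Cox, Thm. 12.34, the
case to which its proof reduces; here by Baker's route, *Transcendental Number Theory* Ch. 5 §4):
for a prime `p ≡ 3 (mod 8)`, `h(−p) = 1 ⟹ p ∈ {3, 11, 19, 43, 67, 163}`. Discharge of the named
fact `HeegnerStarkPrimeThreeModEight`: the small range `p ≤ 500000` and the medium range
`p ≤ 10¹⁰⁰` are `heegnerStarkPrimeThreeModEight_of_large_above` (fed with `bakerX_21_eq`,
`bakerX_33_eq`), the range `p > 10¹⁰⁰ > 10⁸⁰` is `baker_large_range`.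
[cite: Cox2013, §12.E Thm. 12.34 (proof, case p ≡ 3 mod 8)] -/
theorem HeegnerStarkPrimeThreeModEight_holds : HeegnerStarkPrimeThreeModEight :=
  heegnerStarkPrimeThreeModEight_of_large_above bakerX_21_eq bakerX_33_eq
    fun p₀ hp h8 hgt h₂₁ h₃₃ ha hb hc hd =>
      baker_large_range p₀ hp h8 (lt_trans (by norm_num) hgt) h₂₁ h₃₃ ha hb hc hd

/-- **The Heegner–Stark–Baker theorem for odd field discriminants** (Cox, Thm. 7.30(i) =
Thm. 12.34 for `d_K ≡ 1 (mod 4)`): if `D < 0`, `D ≡ 1 (mod 4)` is square-free and `h(D) = 1`,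
then `D ∈ {−3, −7, −11, −19, −43, −67, −163}`. Discharge of the named fact `HeegnerStarkOddDiscr`,
by the reduction `heegnerStarkOddDiscr_of_prime` (first part of Cox's proof of Thm. 12.34:
genus step and the case `p ≡ 7 (mod 8)`) and `HeegnerStarkPrimeThreeModEight_holds`.
[cite: Cox2013, §7.D Thm. 7.30(i) and §12.E Thm. 12.34] -/
theorem HeegnerStarkOddDiscr_holds : HeegnerStarkOddDiscr :=
  heegnerStarkOddDiscr_of_prime HeegnerStarkPrimeThreeModEight_holds

/-- **Cox, Thm. 7.30(ii), unconditionally**: for `D < 0`, `D ≡ 0, 1 (mod 4)`, `h(D) = 1` implies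
`D ∈ {−3, −4, −7, −8, −11, −12, −16, −19, −27, −28, −43, −67, −163}` — the named fact
`mem_classNumberOneDiscrs_of_classNumber_eq_one` of `ReducedForms.lean`, discharged through
`mem_classNumberOneDiscrs_of_classNumber_eq_one_of_heegnerStarkPrime`.
[cite: Cox2013, §7.D Thm. 7.30(ii)] -/
theorem mem_classNumberOneDiscrs_of_classNumber_eq_one_holds :
    mem_classNumberOneDiscrs_of_classNumber_eq_one :=
  mem_classNumberOneDiscrs_of_classNumber_eq_one_of_heegnerStarkPrime
    HeegnerStarkPrimeThreeModEight_holds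

end Literature.NumberTheory.QuadraticFields.BinaryQuadraticForm

/-- **Cox, Thm. 7.30(ii) as an `iff` in the `BinQF` encoding, unconditionally**: discharge of the
named fact `Quadratic.BinQF.BakerHeegnerStark_classNumber_eq_one_iff`
(`BinaryQuadraticFormsClassNumber.lean`) through
`binQF_bakerHeegnerStark_of_heegnerStarkPrime`. [cite: Cox2013, §7.D Thm. 7.30(ii)] -/
theorem Literature.NumberTheory.QuadraticFields.Quadratic.BinQF.BakerHeegnerStark_classNumber_eq_one_iff_holds :
    Literature.NumberTheory.QuadraticFields.Quadratic.BinQF.BakerHeegnerStark_classNumber_eq_one_iff :=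
  Literature.NumberTheory.QuadraticFields.BinaryQuadraticForm.binQF_bakerHeegnerStark_of_heegnerStarkPrime
    Literature.NumberTheory.QuadraticFields.BinaryQuadraticForm.HeegnerStarkPrimeThreeModEight_holds
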